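import Summits.ValiantsHypothesis.ValiantsHypothesis.Theorems.TwistedDetRankSliceVBPFermionicReturnGadget
import Mathlib.LinearAlgebra.Matrix.SchurComplement

/-!
# Crux `TwistedDetRank.SliceVBPFermionic` (stmt-ValiantsHypothesis-17991, X2b) — the item's named
# falsifier, the `2`-cycle twist `sgn · μ^{c₂}`, is `VNP ⊄ VBP`-hard

Sequel to Theorems/TwistedDetRankSliceVBPFermionicReturnGadget.lean (the bipartite return gadget:
every class-function GMF `f_{2a}` on `S_{2a}` projects onto `c_a(χ) · per_a`, `c_a` the doubling
sum, and a VBP-slice family with eventually non-zero doubling sums forces `¬ DcPerSuperpolynomial ℂ`).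

The `why it might fail` of item stmt-ValiantsHypothesis-17991 names ONE falsifier of X2b: the
`2`-cycle twist `χ_μ = sgn · μ^{c₂}` (`c₂` = number of `2`-cycles), "tdr ≥ 2^{n/4} by the landed
block-swap flattening; it refutes X2b iff its GMF `Σ_M (1−μ)^{|M|} X^M det(X_{M̄})` has polynomial
dc (expected VNP-hard, Burgisser2000 Ch. 7; open)".  Here (all kernel-checked, no named facts):

* `numTwoCycles`, `twoCycleTwist` — the family, a class function (`twoCycleTwist_conj`);
* `doublingSum_twoCycleTwist` — its doubling sum on `S_{a+a}` is `ε · det((μ−1)·1 + J_a)`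
  (`ε` the sign of the block swap): the doubled permutation `σ_{1,ρ}` has sign `ε · sgn ρ` and
  exactly `c₁(ρ)` two-cycles, and `Σ_ρ sgn ρ · μ^{c₁(ρ)} = det((μ−1)·1 + J)` (`Matrix.det_apply'`);
* `det_diag_ones_ne_zero` — `det((t−1)·1 + J_a) = (t−1)^a (1 + a (t−1)⁻¹) ≠ 0` for `t ≠ 1`,
  `t − 1 + a ≠ 0` (matrix determinant lemma), whence `doublingSum_twoCycleTwist_ne_zero`: for
  `μ ≠ 1` the doubling sums are non-zero from `a > ‖μ − 1‖` on;
* `not_dcPerSuperpolynomial_of_twoCycleTwist_hasDetRepr` — **if the `2`-cycle twist family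
  (`μ ≠ 1`; `μ = 1` is the determinant) has affine determinantal representations of p-bounded
  size then so does the permanent**: the family is `VNP ⊄ VBP`-hard (`per_a` is a projection of
  `f_{2a}` up to the non-zero scalar `c_a`), settling the item's "expected VNP-hard; open"; and
  `twoCycleTwist_not_hasDetRepr_of_dcPerSuperpolynomial` — under Valiant's determinantal
  hypothesis the family does not satisfy the hypothesis of `SliceVBPFermionic`, so it cannot
  witness `¬ SliceVBPFermionic`.  (In the world `VBP = VNP` X2b is false already at `χ ≡ 1`.)

HONEST FRAMING.  Census work on the refutation side of X2b (which is ≥ `VNP ⊄ VBP`,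
Theorems/TwistedDetRankSliceVBPFermionicCalibration.lean); `VP ≠ VNP` is not moved by this item.

References: P. Bürgisser, *Completeness and Reduction in Algebraic Complexity Theory* (2000) §2.5,
Ch. 7; S. Mertens, C. Moore, Theory of Computing 9 (2013), Thms 1–2; L. G. Valiant, STOC 1979.
The `def`s `numTwoCycles`, `twoCycleTwist` are proof gadgets naming the witness family, not route
objects.
-/

-- single-conjunct layout: Sub = Summit, duplicated namespace component intended
set_option linter.dupNamespace false

noncomputable section

namespace Summit.ValiantsHypothesis.ValiantsHypothesis.Theorems.TwistedDetRankSliceVBPFermionic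

open Equiv MvPolynomial Literature.Computability.AlgebraicComplexity
open Summit.ValiantsHypothesis.ValiantsHypothesis.Theorems.TwistedDetRankFermionicNormalForm
open scoped BigOperators

/-! ## §1 The `2`-cycle twist `sgn · μ^{c₂}` (the item's named falsifier) is `VNP ⊄ VBP`-hard -/

section TwoCycle

variable {α : Type*} [Fintype α] [DecidableEq α]

/-- `c₂(σ)`, the number of `2`-cycles of `σ`: half the number of points `z` with `σ² z = z ≠ σ z`.
A proof gadget, not a route object. [folklore] -/
def numTwoCycles (σ : Perm α) : ℕ :=
  (Finset.univ.filter fun z => σ (σ z) = z ∧ σ z ≠ z).card / 2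

/-- `c₂` is a class function. [folklore] -/
theorem numTwoCycles_conj (σ τ : Perm α) : numTwoCycles (τ * σ * τ⁻¹) = numTwoCycles σ := by
  unfold numTwoCycles
  congr 1
  refine Finset.card_equiv (τ⁻¹ : Perm α) fun z => ?_
  simp only [Finset.mem_filter, Finset.mem_univ, true_and, Perm.mul_apply, Perm.coe_inv, ne_eq,
    Equiv.symm_apply_apply, Equiv.apply_eq_iff_eq_symm_apply]

/-- `c₂` is invariant under transport of structure. [folklore] -/
theorem numTwoCycles_permCongr {β : Type*} [Fintype β] [DecidableEq β] (e : α ≃ β) (σ : Perm α) :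
    numTwoCycles (e.permCongr σ) = numTwoCycles σ := by
  unfold numTwoCycles
  congr 1
  refine Finset.card_equiv e.symm fun z => ?_
  simp only [Finset.mem_filter, Finset.mem_univ, true_and, Equiv.permCongr_apply, ne_eq,
    Equiv.symm_apply_apply, Equiv.apply_eq_iff_eq_symm_apply]

variable {a : ℕ}

/-- The doubled permutation `σ_{1,ρ}` has exactly `c₁(ρ)` two-cycles (the pairs
`{inl i, inr i}` over the fixed points `i` of `ρ`). [folklore] -/
theorem numTwoCycles_swapPerm_one (ρ : Perm (Fin a)) :
    numTwoCycles (swapPerm 1 ρ) = (Finset.univ.filter fun i => ρ i = i).card := by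
  unfold numTwoCycles
  have hcard : (Finset.univ.filter fun z : Fin a ⊕ Fin a =>
      swapPerm 1 ρ (swapPerm 1 ρ z) = z ∧ swapPerm 1 ρ z ≠ z).card =
        2 * (Finset.univ.filter fun i => ρ i = i).card := by
    rw [Finset.card_filter, Fintype.sum_sum_type, Finset.card_filter, two_mul]
    congr 1
    · refine Finset.sum_congr rfl fun i _ => ?_
      simp
    · refine Finset.sum_congr rfl fun i _ => ?_
      simp
  rw [hcard, Nat.mul_div_cancel_left _ Nat.two_pos]

/-- THE `2`-CYCLE TWIST `χ_μ(σ) = sgn σ · μ^{c₂(σ)}` (the falsifier named in the item's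
`why it might fail`: "polynomial dc but exponential tdr … it refutes X2b iff its GMF
`Σ_M (1−μ)^{|M|} X^M det(X_{M̄})` has polynomial dc (expected VNP-hard; open)").
A proof gadget naming that family, not a route object. [folklore] -/
def twoCycleTwist (μ : ℂ) (n : ℕ) (σ : Perm (Fin n)) : ℂ :=
  ((Perm.sign σ : ℤ) : ℂ) * μ ^ numTwoCycles σ

/-- The `2`-cycle twist is a class function. [folklore] -/
theorem twoCycleTwist_conj (μ : ℂ) (n : ℕ) (σ τ : Perm (Fin n)) :
    twoCycleTwist μ n (τ * σ * τ⁻¹) = twoCycleTwist μ n σ := by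
  unfold twoCycleTwist
  rw [numTwoCycles_conj, Perm.sign_mul, Perm.sign_mul, Perm.sign_inv, mul_right_comm,
    Int.units_mul_self, one_mul]

/-- The signed fixed-point generating sum is a determinant:
`Σ_ρ sgn ρ · t^{c₁(ρ)} = det((t−1)·1 + J)`. [folklore] -/
theorem sum_sign_mul_pow_fix_eq_det (t : ℂ) :
    ∑ ρ : Perm (Fin a), ((Perm.sign ρ : ℤ) : ℂ) * t ^ (Finset.univ.filter fun i => ρ i = i).card =
      (Matrix.of fun i j : Fin a => if i = j then t else (1 : ℂ)).det := by
  rw [Matrix.det_apply']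
  refine Finset.sum_congr rfl fun ρ _ => ?_
  congr 1
  simp only [Matrix.of_apply]
  rw [Finset.prod_ite, Finset.prod_const_one, mul_one, Finset.prod_const]

/-- `det((t−1)·1 + J) = (t−1)^a · (1 + a (t−1)⁻¹)` is non-zero for `t ≠ 1`, `t − 1 + a ≠ 0`
(matrix determinant lemma, `Matrix.det_one_add_replicateCol_mul_replicateRow`). [folklore] -/
theorem det_diag_ones_ne_zero (t : ℂ) (ht : t ≠ 1) (hta : t - 1 + (a : ℂ) ≠ 0) :
    (Matrix.of fun i j : Fin a => if i = j then t else (1 : ℂ)).det ≠ 0 := by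
  have ht' : t - 1 ≠ 0 := sub_ne_zero.2 ht
  have hM : (Matrix.of fun i j : Fin a => if i = j then t else (1 : ℂ)) =
      (t - 1) • (1 + Matrix.replicateCol Unit (fun _ : Fin a => (t - 1)⁻¹) *
        Matrix.replicateRow Unit (fun _ : Fin a => (1 : ℂ))) := by
    ext i j
    simp only [Matrix.of_apply, Matrix.smul_apply, Matrix.add_apply, Matrix.mul_apply,
      Matrix.replicateCol_apply, Matrix.replicateRow_apply, Finset.univ_unique,
      Finset.sum_singleton, mul_one, smul_eq_mul, Matrix.one_apply]
    split_ifs with h <;> field_simp <;> ring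
  rw [hM, Matrix.det_smul, Matrix.det_one_add_replicateCol_mul_replicateRow, Fintype.card_fin]
  refine mul_ne_zero (pow_ne_zero _ ht') ?_
  have hdot : (fun _ : Fin a => (1 : ℂ)) ⬝ᵥ (fun _ : Fin a => (t - 1)⁻¹) = (a : ℂ) * (t - 1)⁻¹ := by
    simp [dotProduct]
  rw [hdot]
  have : (1 : ℂ) + (a : ℂ) * (t - 1)⁻¹ = (t - 1 + a) / (t - 1) := by
    field_simp
  rw [this]
  exact div_ne_zero hta ht'

/-- The doubling sum of the `2`-cycle twist on `S_{a+a}` is `± det((μ−1)·1 + J_a)`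
(sign of the block swap; `sgn σ_{1,ρ} = ε · sgn ρ`, `c₂(σ_{1,ρ}) = c₁(ρ)`). [folklore] -/
theorem doublingSum_twoCycleTwist (μ : ℂ) :
    doublingSum (twoCycleTwist μ (a + a)) =
      ((Perm.sign (Equiv.sumComm (Fin a) (Fin a) : Perm (Fin a ⊕ Fin a)) : ℤ) : ℂ) *
        (Matrix.of fun i j : Fin a => if i = j then μ else (1 : ℂ)).det := by
  rw [← sum_sign_mul_pow_fix_eq_det, doublingSum, Finset.mul_sum]
  refine Finset.sum_congr rfl fun ρ _ => ?_
  rw [twoCycleTwist, Perm.sign_permCongr, numTwoCycles_permCongr, sign_swapPerm,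
    numTwoCycles_swapPerm_one, Perm.sign_one, mul_one]
  push_cast
  ring

/-- For `μ ≠ 1` the doubling sums of the `2`-cycle twist are eventually non-zero
(from `a > ‖μ − 1‖` on, `μ − 1 + a ≠ 0`). [folklore] -/
theorem doublingSum_twoCycleTwist_ne_zero {μ : ℂ} (hμ : μ ≠ 1) :
    ∃ a₀ : ℕ, ∀ a : ℕ, a₀ ≤ a → doublingSum (twoCycleTwist μ (a + a)) ≠ 0 := by
  refine ⟨⌈‖μ - 1‖⌉₊ + 1, fun a ha => ?_⟩
  rw [doublingSum_twoCycleTwist]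
  refine mul_ne_zero (Int.cast_ne_zero.2 (Units.ne_zero _)) (det_diag_ones_ne_zero μ hμ ?_)
  intro h
  have h1 : (a : ℂ) = -(μ - 1) := by linear_combination h
  have h2 : (a : ℝ) = ‖μ - 1‖ := by
    have := congrArg norm h1
    rw [norm_neg] at this
    simpa using this
  have h3 : ‖μ - 1‖ ≤ ⌈‖μ - 1‖⌉₊ := Nat.le_ceil _
  have h4 : ((⌈‖μ - 1‖⌉₊ + 1 : ℕ) : ℝ) ≤ (a : ℝ) := by exact_mod_cast ha
  push_cast at h4
  linarith

/-- **The named falsifier is `VNP ⊄ VBP`-hard.**  If the GMF family of the `2`-cycle twist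
`sgn · μ^{c₂}` (`μ ≠ 1`; at `μ = 1` it is the determinant) has affine determinantal
representations of p-bounded size, then so does the permanent (`¬ DcPerSuperpolynomial ℂ`): the
`J`-gadget projects `f_{2a}` onto `± det((μ−1)·1 + J_a) · per_a`, and that scalar is non-zero
for `a > ‖μ − 1‖`.  So this family refutes X2b only in the world `VBP = VNP`, where X2b is
already false at `χ ≡ 1`; it is not an independent falsifier. [folklore] -/
theorem not_dcPerSuperpolynomial_of_twoCycleTwist_hasDetRepr {μ : ℂ} (hμ : μ ≠ 1)
    (hdc : ∃ c : ℕ, ∀ n : ℕ, ∃ m ≤ n ^ c + c,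
      HasDetRepr (∑ σ : Perm (Fin n), C (twoCycleTwist μ n σ) *
        ∏ i, (X (σ i, i) : MvPolynomial (Fin n × Fin n) ℂ)) m) :
    ¬ DcPerSuperpolynomial ℂ := by
  obtain ⟨a₀, ha₀⟩ := doublingSum_twoCycleTwist_ne_zero hμ
  exact not_dcPerSuperpolynomial_of_hasDetRepr_of_doublingSum_ne_zero (twoCycleTwist μ)
    (twoCycleTwist_conj μ) ha₀ hdc

/-- Contrapositive, as the crux reads it: under Valiant's determinantal hypothesis the `2`-cycle
twist family does NOT satisfy the hypothesis of `SliceVBPFermionic`, so it cannot witness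
`¬ SliceVBPFermionic`. [folklore] -/
theorem twoCycleTwist_not_hasDetRepr_of_dcPerSuperpolynomial (h : DcPerSuperpolynomial ℂ)
    {μ : ℂ} (hμ : μ ≠ 1) :
    ¬ ∃ c : ℕ, ∀ n : ℕ, ∃ m ≤ n ^ c + c,
      HasDetRepr (∑ σ : Perm (Fin n), C (twoCycleTwist μ n σ) *
        ∏ i, (X (σ i, i) : MvPolynomial (Fin n × Fin n) ℂ)) m :=
  fun hdc => not_dcPerSuperpolynomial_of_twoCycleTwist_hasDetRepr hμ hdc h

end TwoCycle

end Summit.ValiantsHypothesis.ValiantsHypothesis.Theorems.TwistedDetRankSliceVBPFermionic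

end
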